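import Summits.CriticalPhenomena.SAWScalingLimit.Theorems.SAWDefectDecoherenceBoundaryClosureRPolygonGreenLayers
import HarnessLib

/-!
# Polygon Green pairing, III: darts and the boundary part of the functional
(crux `BoundaryClosureR`, stmt-CriticalPhenomena-14004, line `polygon-parity-squeeze`, registered
stub `polygonGreenPairing`, mechanism (A1a))

The third error term of the Taylor-expanded discrete Green identity, the boundary part
`Q_δ = δ² Σᶠ_{e ∈ ∂Ω_δ} ∂̄φ(δ mid e) F(e)/F(b_δ)` of the functional `N_δ(∂̄φ)`, for a GENERAL domain `Λ`
rooted at a boundary dart `{u, w}`: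

* `sum_darts_eq_finsum`, `finsum_boundary_eq_sum_darts`, `card_filter_nbrs_le` … — dart sums versus the
  `finsum`s over darts / boundary mid-edges of the registered statement;
* `norm_boundary_finsum_le_depthZero` — `‖Σᶠ_{∂Ω} ψ(δ mid e) F(e)‖ ≤ 3 x_c ‖ψ‖_∞ Σ_v starMass(v)` over the
  DEPTH-ZERO vertices near `supp ψ` (dangling mass bound `PolygonGreen.norm_obs_zero_dart_le`), provided
  `ψ(δ·mid)` vanishes on the darts of the root vertex `w`;
* `boundary_mesh_le` — after the cover of `…PolygonGreenPairing.lean` (budget balls + a bulk set of deep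
  vertices, which has no depth-zero vertex): `‖Q_δ‖ ≤ 3 M₁ (Σ_x C_x) δ` (registered form
  `polygonGreen_boundaryMesh`).

Reference: Duminil-Copin–Smirnov, Ann. of Math. 175 (2012), §2–§3.
-/

noncomputable section

open scoped BigOperators Topology Classical ComplexConjugate
open Filter Set Metric Complex
open Literature.Probability.LatticeModels Literature.Probability.RandomPlanarGeometry
open Literature.Probability.RandomPlanarGeometry.SAW
open Literature.Barriers.CriticalPhenomena.HexGreen (nbrs mem_nbrs_iff)
open Summit.CriticalPhenomena.SAWScalingLimit.Theorems.PickHalfPlane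
open Summit.CriticalPhenomena.SAWScalingLimit.Theorems.ObservableToSLE.FloorRatio (dist_smul_mesh)
open Summit.CriticalPhenomena.SAWScalingLimit.Theorems.DecoherenceSynthesis (norm_hexMidpoint_sub_hexCenter_le)

namespace Summit.CriticalPhenomena.SAWScalingLimit.Theorems.PolygonParitySqueeze.PolygonGreen

/-! ### 1. Dart sums and boundary sums -/

/-- **Dart sums as a `finsum` over darts.** `Σ_{v ∈ Λ} Σ_{t ∼ v, t ∉ Λ} f(v,t) = Σᶠ_{(v,t) dart} f`.
[cite: DuminilCopinSmirnov2012, §2 (domains)] -/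
theorem sum_darts_eq_finsum {M : Type*} [AddCommMonoid M] (Λ : Finset HexVertex)
    (f : HexVertex × HexVertex → M) :
    ∑ v ∈ Λ, ∑ t ∈ (nbrs v).filter (· ∉ Λ), f (v, t) =
      ∑ᶠ p ∈ {p : HexVertex × HexVertex | p.1 ∈ Λ ∧ p.2 ∉ Λ ∧ hexGraph.Adj p.1 p.2}, f p := by
  classical
  set D : Finset (HexVertex × HexVertex) := (Λ ×ˢ Λ.biUnion nbrs).filter
    (fun p => p.2 ∉ Λ ∧ p.2 ∈ nbrs p.1) with hD
  have hmem : ∀ p : HexVertex × HexVertex, p ∈ D ↔ p.1 ∈ Λ ∧ p.2 ∈ (nbrs p.1).filter (· ∉ Λ) := by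
    intro p
    simp only [hD, Finset.mem_filter, Finset.mem_product, Finset.mem_biUnion]
    constructor
    · rintro ⟨⟨h1, -⟩, h2, h3⟩; exact ⟨h1, h3, h2⟩
    · rintro ⟨h1, h3, h2⟩; exact ⟨⟨h1, p.1, h1, h3⟩, h2, h3⟩
  have hset : (↑D : Set (HexVertex × HexVertex)) =
      {p : HexVertex × HexVertex | p.1 ∈ Λ ∧ p.2 ∉ Λ ∧ hexGraph.Adj p.1 p.2} := by
    ext p
    rw [Finset.mem_coe, hmem, Set.mem_setOf_eq, Finset.mem_filter, mem_nbrs_iff]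
    tauto
  rw [← hset, finsum_mem_coe_finset, Finset.sum_finset_product D Λ (fun v => (nbrs v).filter (· ∉ Λ)) hmem]

/-- **Boundary sums as dart sums.** `Σᶠ_{e ∈ ∂Ω(Λ)} g e = Σ_{v ∈ Λ} Σ_{t ∼ v, t ∉ Λ} g {v,t}` (a boundary
mid-edge has exactly one endpoint in `Λ`). [cite: DuminilCopinSmirnov2012, §2 (domains)] -/
theorem finsum_boundary_eq_sum_darts {M : Type*} [AddCommMonoid M] (Λ : Finset HexVertex)
    (g : Sym2 HexVertex → M) :
    ∑ᶠ e ∈ hexDomainBoundary Λ, g e = ∑ v ∈ Λ, ∑ t ∈ (nbrs v).filter (· ∉ Λ), g s(v, t) := by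
  classical
  set D : Finset (HexVertex × HexVertex) := (Λ ×ˢ Λ.biUnion nbrs).filter
    (fun p => p.2 ∉ Λ ∧ p.2 ∈ nbrs p.1) with hD
  have hmem : ∀ p : HexVertex × HexVertex, p ∈ D ↔ p.1 ∈ Λ ∧ p.2 ∈ (nbrs p.1).filter (· ∉ Λ) := by
    intro p
    simp only [hD, Finset.mem_filter, Finset.mem_product, Finset.mem_biUnion]
    constructor
    · rintro ⟨⟨h1, -⟩, h2, h3⟩; exact ⟨h1, h3, h2⟩
    · rintro ⟨h1, h3, h2⟩; exact ⟨⟨h1, p.1, h1, h3⟩, h2, h3⟩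
  have hinj : Set.InjOn (fun p : HexVertex × HexVertex => s(p.1, p.2)) ↑D := by
    intro p hp q hq hpq
    rw [Finset.mem_coe, hmem] at hp hq
    rcases Sym2.eq_iff.1 hpq with ⟨h1, h2⟩ | ⟨h1, h2⟩
    · exact Prod.ext h1 h2
    · exact absurd (h1 ▸ hp.1) (Finset.mem_filter.1 hq.2).2
  have himg : (↑(D.image fun p : HexVertex × HexVertex => s(p.1, p.2)) : Set (Sym2 HexVertex)) =
      hexDomainBoundary Λ := by
    ext e
    simp only [Finset.coe_image, Set.mem_image, Finset.mem_coe, hmem, Finset.mem_filter, mem_nbrs_iff]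
    constructor
    · rintro ⟨p, ⟨h1, h2, h3⟩, rfl⟩
      exact ⟨(SimpleGraph.mem_edgeSet hexGraph).2 h2, p.2, p.1, Sym2.eq_swap, h1, h3⟩
    · rintro ⟨he, u', v', rfl, hv', hu'⟩
      exact ⟨(v', u'), ⟨hv', ((SimpleGraph.mem_edgeSet hexGraph).1 he).symm, hu'⟩, Sym2.eq_swap⟩
  rw [← himg, finsum_mem_coe_finset, Finset.sum_image hinj,
    Finset.sum_finset_product' D Λ (fun v => (nbrs v).filter (· ∉ Λ)) hmem (f := fun v t => g s(v, t))]

/-! ### 2. The boundary part of the functional: depth-zero stars -/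

/-- **The boundary part is carried by depth-zero stars.** Let `Λ` be rooted at the dart `{u, w}`
(`u ∉ Λ ∋ w`), `‖ψ‖ ≤ Mψ`, `ψ ≠ 0` only on `S`, and suppose `ψ(δ·mid)` vanishes on the three mid-edges at
the root vertex `w`.  Then `‖Σᶠ_{e ∈ ∂Ω} ψ(δ mid e) F_{5/8}(e)‖ ≤ 3 x_c Mψ Σ_v starMass(v)`, the sum over
the vertices of `Λ` of metric depth `0` with scaled centre in the `δ/2`-thickening of `S` (write the
boundary sum over darts, `‖F_{5/8}‖ ≤ Z ≤ x_c·starMass` at a dart off the root vertex, three darts per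
vertex). [cite: DuminilCopinSmirnov2012, §2 (walks between mid-edges)] -/
theorem norm_boundary_finsum_le_depthZero {Λ : Finset HexVertex} {u w : HexVertex} (hu : u ∉ Λ)
    {δ : ℝ} (hδ : 0 ≤ δ) {ψ : ℂ → ℂ} {Mψ : ℝ} {S : Set ℂ} (hMψ : ∀ z, ‖ψ z‖ ≤ Mψ)
    (hψs : ∀ z, ψ z ≠ 0 → z ∈ S)
    (hroot : ∀ t : HexVertex, hexGraph.Adj w t → ψ ((δ : ℂ) * hexMidpoint s(w, t)) = 0) :
    ‖∑ᶠ e ∈ hexDomainBoundary Λ, ψ ((δ : ℂ) * hexMidpoint e) *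
        hexParafermionicObservable Λ s(u, w) hexCriticalFugacity (5 / 8) e‖ ≤
      3 * hexCriticalFugacity * Mψ * ∑ v ∈ Λ.filter (fun v =>
        (δ : ℂ) * hexCenter v ∈ cthickening (δ / 2) S ∧ IsMetricDepth Λ v 0), starMass Λ s(u, w) v := by
  classical
  set F := hexParafermionicObservable Λ s(u, w) hexCriticalFugacity (5 / 8) with hF
  set Z := hexParafermionicObservable Λ s(u, w) hexCriticalFugacity 0 with hZ
  set x : ℝ := hexCriticalFugacity with hx
  have hx0 : 0 ≤ x := hexCriticalFugacity_pos_lt_one.1.le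
  have hMψ0 : 0 ≤ Mψ := (norm_nonneg _).trans (hMψ 0)
  have hstar0 : ∀ v, 0 ≤ starMass Λ s(u, w) v := fun v => Finset.sum_nonneg fun t _ => norm_nonneg _
  set G : HexVertex → ℝ := fun v =>
    if (δ : ℂ) * hexCenter v ∈ cthickening (δ / 2) S ∧ IsMetricDepth Λ v 0 then x * Mψ * starMass Λ s(u, w) v
    else 0 with hG
  have hG0 : ∀ v, 0 ≤ G v := fun v => by
    simp only [hG]; split_ifs
    · exact mul_nonneg (mul_nonneg hx0 hMψ0) (hstar0 v)
    · exact le_rfl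
  rw [finsum_boundary_eq_sum_darts]
  -- per dart
  have hdart : ∀ v ∈ Λ, ∀ t ∈ (nbrs v).filter (· ∉ Λ), ‖ψ ((δ : ℂ) * hexMidpoint s(v, t)) * F s(v, t)‖ ≤ G v := by
    intro v hv t ht
    obtain ⟨htn, htΛ⟩ := Finset.mem_filter.1 ht
    have hadj : hexGraph.Adj v t := (mem_nbrs_iff _ _).1 htn
    by_cases hψ0 : ψ ((δ : ℂ) * hexMidpoint s(v, t)) = 0
    · rw [hψ0, zero_mul, norm_zero]; exact hG0 v
    have hvw : v ≠ w := by rintro rfl; exact hψ0 (hroot t hadj)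
    have hvS : (δ : ℂ) * hexCenter v ∈ cthickening (δ / 2) S := by
      refine mem_cthickening_of_dist_le _ _ _ _ (hψs _ hψ0) ?_
      rw [dist_comm, dist_smul_mesh hδ, dist_eq_norm]
      exact (mul_le_mul_of_nonneg_left (norm_hexMidpoint_sub_hexCenter_le hadj) hδ).trans (by linarith)
    have hdep : IsMetricDepth Λ v 0 := isMetricDepth_zero_of_dart hv hadj htΛ
    have hGv : G v = x * Mψ * starMass Λ s(u, w) v := by simp only [hG, if_pos (And.intro hvS hdep)]
    rw [hGv, norm_mul]
    have h1 : ‖F s(v, t)‖ ≤ x * starMass Λ s(u, w) v :=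
      (GateMass.norm_obs_le_norm_obs_zero Λ s(u, w) (5 / 8) s(v, t)).trans (norm_obs_zero_dart_le hu hv htΛ hvw)
    calc ‖ψ ((δ : ℂ) * hexMidpoint s(v, t))‖ * ‖F s(v, t)‖ ≤ Mψ * (x * starMass Λ s(u, w) v) :=
          mul_le_mul (hMψ _) h1 (norm_nonneg _) hMψ0
      _ = x * Mψ * starMass Λ s(u, w) v := by ring
  calc ‖∑ v ∈ Λ, ∑ t ∈ (nbrs v).filter (· ∉ Λ), ψ ((δ : ℂ) * hexMidpoint s(v, t)) * F s(v, t)‖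
      ≤ ∑ v ∈ Λ, ∑ t ∈ (nbrs v).filter (· ∉ Λ), ‖ψ ((δ : ℂ) * hexMidpoint s(v, t)) * F s(v, t)‖ :=
        (norm_sum_le _ _).trans (Finset.sum_le_sum fun v _ => norm_sum_le _ _)
    _ ≤ ∑ v ∈ Λ, ∑ _t ∈ (nbrs v).filter (· ∉ Λ), G v := Finset.sum_le_sum fun v hv => Finset.sum_le_sum (hdart v hv)
    _ ≤ ∑ v ∈ Λ, 3 * G v := by
        refine Finset.sum_le_sum fun v _ => ?_
        rw [Finset.sum_const, nsmul_eq_mul]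
        exact mul_le_mul_of_nonneg_right (by exact_mod_cast card_filter_nbrs_le v _) (hG0 v)
    _ = 3 * x * Mψ * ∑ v ∈ Λ.filter (fun v =>
          (δ : ℂ) * hexCenter v ∈ cthickening (δ / 2) S ∧ IsMetricDepth Λ v 0), starMass Λ s(u, w) v := by
        rw [← Finset.mul_sum, Finset.sum_filter, Finset.mul_sum, Finset.mul_sum]
        refine Finset.sum_congr rfl fun v _ => ?_
        simp only [hG]
        split_ifs <;> ring

/-! ### 3. The boundary part of the functional at one mesh -/

/-- **The boundary part at one mesh, after the cover.** Let `Λ` be rooted at the dart `{u, w}`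
(`u ∉ Λ ∋ w`), `‖ψ‖ ≤ M₁`, `ψ ≠ 0` only on `S`, `ψ(δ·mid)` vanishing on the mid-edges at the root vertex,
every bulk vertex `(η₁/δ)`-deep with `η₁ ≥ δ`, and the cover `hsplit`.  Then
`‖δ² (Σᶠ_{∂Ω} ψ(δ mid e) F(e)) / F(b)‖ ≤ 3 M₁ (Σ_{x ∈ t} C_x) δ` (only the depth-`0` layers of the budgets
are used). [cite: DuminilCopinSmirnov2012, §2 (walks between mid-edges)] -/
theorem boundary_mesh_le {Λ : Finset HexVertex} {u w : HexVertex} {b : Sym2 HexVertex} {δ η₁ M₁ : ℝ} {K : ℕ}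
    {t : Finset ℂ} {r Cb : ℂ → ℝ} {T S : Set ℂ} {ψ : ℂ → ℂ} (hu : u ∉ Λ)
    (hδ : 0 < δ) (hδη₁ : δ ≤ η₁)
    (hdepthK : ∀ v ∈ Λ, ∀ k : ℕ, IsMetricDepth Λ v k → k ≤ K)
    (hCb : ∀ x ∈ t, 0 ≤ Cb x)
    (hbudget : ∀ x ∈ t, ∀ k : ℕ, δ * (∑ᶠ v ∈ {v : HexVertex | v ∈ Λ ∧ (δ : ℂ) * hexCenter v ∈ ball x (r x) ∧
        IsMetricDepth Λ v k}, starMass Λ s(u, w) v) ≤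
      Cb x * ((k : ℝ) + 1) ^ (3 / 4 : ℝ) * ‖hexParafermionicObservable Λ s(u, w) hexCriticalFugacity 0 b‖)
    (hdeep : ∀ v ∈ Λ, (δ : ℂ) * hexCenter v ∈ T → ∀ y : HexVertex, dist (hexCenter y) (hexCenter v) ≤ η₁ / δ → y ∈ Λ)
    (hsplit : ∀ v ∈ Λ, (δ : ℂ) * hexCenter v ∈ cthickening (δ / 2) S →
      (∃ x ∈ t, (δ : ℂ) * hexCenter v ∈ ball x (r x)) ∨ (δ : ℂ) * hexCenter v ∈ T)
    (hM₁ : ∀ z, ‖ψ z‖ ≤ M₁) (hψs : ∀ z, ψ z ≠ 0 → z ∈ S)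
    (hroot : ∀ t' : HexVertex, hexGraph.Adj w t' → ψ ((δ : ℂ) * hexMidpoint s(w, t')) = 0)
    (hFb : ‖hexParafermionicObservable Λ s(u, w) hexCriticalFugacity (5 / 8) b‖ =
      ‖hexParafermionicObservable Λ s(u, w) hexCriticalFugacity 0 b‖)
    (hZb : 0 < ‖hexParafermionicObservable Λ s(u, w) hexCriticalFugacity 0 b‖) :
    ‖(δ : ℂ) ^ 2 * (∑ᶠ e ∈ hexDomainBoundary Λ, ψ ((δ : ℂ) * hexMidpoint e) *
        hexParafermionicObservable Λ s(u, w) hexCriticalFugacity (5 / 8) e) /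
        hexParafermionicObservable Λ s(u, w) hexCriticalFugacity (5 / 8) b‖ ≤
      3 * M₁ * (∑ x ∈ t, Cb x) * δ := by
  set a : Sym2 HexVertex := s(u, w) with ha
  set F : Sym2 HexVertex → ℂ := hexParafermionicObservable Λ a hexCriticalFugacity (5 / 8) with hFdef
  set Z : Sym2 HexVertex → ℂ := hexParafermionicObservable Λ a hexCriticalFugacity 0 with hZdef
  set Zb : ℝ := ‖Z b‖ with hZbdef
  have hz : Zb ≠ 0 := hZb.ne'
  have hM₁0 : 0 ≤ M₁ := (norm_nonneg _).trans (hM₁ 0)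
  have hx1 : hexCriticalFugacity ≤ 1 := hexCriticalFugacity_pos_lt_one.2.le
  have hx0 : 0 ≤ hexCriticalFugacity := hexCriticalFugacity_pos_lt_one.1.le
  have hstar0 : ∀ v, 0 ≤ starMass Λ a v := fun v => Finset.sum_nonneg fun t _ => norm_nonneg _
  have hCbs : 0 ≤ ∑ x ∈ t, Cb x := Finset.sum_nonneg hCb
  -- (1) the boundary sum is carried by depth-zero stars near the support
  have h1 := norm_boundary_finsum_le_depthZero (Λ := Λ) (w := w) hu hδ.le hM₁ hψs hroot
  -- (2) split: no depth-zero vertex lies in the bulk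
  set ΦQ : HexVertex → ℝ := fun v => if IsMetricDepth Λ v 0 then starMass Λ a v else 0 with hΦQ
  have hΦQ0 : ∀ v, 0 ≤ ΦQ v := fun v => by simp only [hΦQ]; split_ifs; exacts [hstar0 v, le_rfl]
  have hR1 : 1 ≤ η₁ / δ := by rw [le_div_iff₀ hδ]; linarith
  have hsplit' : ∀ v ∈ Λ, ((δ : ℂ) * hexCenter v ∈ cthickening (δ / 2) S ∧ IsMetricDepth Λ v 0) →
      (∃ x ∈ t, (δ : ℂ) * hexCenter v ∈ ball x (r x)) ∨ False := by
    rintro v hv ⟨hvS, hdep⟩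
    rcases hsplit v hv hvS with h | hT
    · exact Or.inl h
    · exact absurd hdep (not_isMetricDepth_zero_of_deep hR1 (hdeep v hv hT))
  have h2 := sum_filter_le_of_cover Λ t (fun v => (δ : ℂ) * hexCenter v ∈ cthickening (δ / 2) S ∧ IsMetricDepth Λ v 0)
    (fun _ => False) (fun x v => (δ : ℂ) * hexCenter v ∈ ball x (r x)) ΦQ hΦQ0 hsplit'
  have hΦQeq : ∑ v ∈ Λ.filter (fun v => (δ : ℂ) * hexCenter v ∈ cthickening (δ / 2) S ∧ IsMetricDepth Λ v 0),
      starMass Λ a v = ∑ v ∈ Λ.filter (fun v =>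
        (δ : ℂ) * hexCenter v ∈ cthickening (δ / 2) S ∧ IsMetricDepth Λ v 0), ΦQ v :=
    Finset.sum_congr rfl fun v hv => by simp only [hΦQ, if_pos (Finset.mem_filter.1 hv).2.2]
  simp only [Finset.filter_false, Finset.sum_empty, add_zero] at h2
  -- (3) balls: the depth-zero layer only
  have h3 : ∀ x ∈ t, δ * ∑ v ∈ Λ.filter (fun v => (δ : ℂ) * hexCenter v ∈ ball x (r x)), ΦQ v ≤ Cb x * Zb := by
    intro x hx
    set wQ : ℕ → ℝ := fun k => if k = 0 then 1 else 0 with hwQ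
    have hwQ0 : ∀ k, 0 ≤ wQ k := fun k => by simp only [hwQ]; split_ifs <;> norm_num
    have hcake := layerCake_depth_le (a := a) hδ.le (hbudget x hx) hdepthK wQ hwQ0 ΦQ (fun v _ k hk => by
      simp only [hΦQ, hwQ]
      by_cases hk0 : k = 0
      · subst hk0; rw [if_pos hk, if_pos rfl, one_mul]
      · rw [if_neg (fun h0 => hk0 (isMetricDepth_unique hk h0)), if_neg hk0, zero_mul])
    have hsum : ∑ k ∈ Finset.range (K + 1), wQ k * ((k : ℝ) + 1) ^ (3 / 4 : ℝ) = 1 := by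
      rw [Finset.sum_eq_single 0 (fun k _ hk => by simp only [hwQ, if_neg hk, zero_mul])
        (fun h => absurd (Finset.mem_range.2 (Nat.succ_pos K)) h)]
      simp [hwQ]
    rw [hsum, mul_one] at hcake
    exact hcake
  -- combine
  rw [norm_div, norm_mul, norm_pow, Complex.norm_real, Real.norm_of_nonneg hδ.le, hFb]
  calc δ ^ 2 * ‖∑ᶠ e ∈ hexDomainBoundary Λ, ψ ((δ : ℂ) * hexMidpoint e) * F e‖ / Zb
      ≤ δ ^ 2 * (3 * hexCriticalFugacity * M₁ * ∑ v ∈ Λ.filter (fun v =>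
          (δ : ℂ) * hexCenter v ∈ cthickening (δ / 2) S ∧ IsMetricDepth Λ v 0), starMass Λ a v) / Zb := by
        gcongr
    _ ≤ δ ^ 2 * (3 * hexCriticalFugacity * M₁ *
          ∑ x ∈ t, ∑ v ∈ Λ.filter (fun v => (δ : ℂ) * hexCenter v ∈ ball x (r x)), ΦQ v) / Zb := by
        rw [hΦQeq]; gcongr
    _ = 3 * hexCriticalFugacity * M₁ * (δ / Zb) *
          ∑ x ∈ t, δ * ∑ v ∈ Λ.filter (fun v => (δ : ℂ) * hexCenter v ∈ ball x (r x)), ΦQ v := by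
        rw [← Finset.mul_sum]; field_simp
    _ ≤ 3 * hexCriticalFugacity * M₁ * (δ / Zb) * ∑ x ∈ t, Cb x * Zb :=
        mul_le_mul_of_nonneg_left (Finset.sum_le_sum h3) (by positivity)
    _ = 3 * hexCriticalFugacity * M₁ * (∑ x ∈ t, Cb x) * δ := by
        rw [← Finset.sum_mul]; field_simp
    _ ≤ 3 * 1 * M₁ * (∑ x ∈ t, Cb x) * δ := by gcongr
    _ = 3 * M₁ * (∑ x ∈ t, Cb x) * δ := by ring

/-! ### Registered form (sub-goal of `polygonGreenPairing`) -/

/-- **Registered sub-goal `polygonGreen_boundaryMesh`** (crux item stmt-CriticalPhenomena-14004, line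
`polygon-parity-squeeze`, stub `polygonGreenPairing`, mechanism (A1a)): registry form (one `∀`-term) of
`boundary_mesh_le` — the boundary part of `N_δ(ψ)` at one mesh is `O(δ)` given the depth-zero layers of
the budgets on a cover. [cite: DuminilCopinSmirnov2012, §2 (walks between mid-edges)] -/
theorem polygonGreen_boundaryMesh : ∀ (Λ : Finset HexVertex) (u w : HexVertex) (b : Sym2 HexVertex) (δ η₁ M₁ : ℝ) (K : ℕ) (t : Finset ℂ) (r Cb : ℂ → ℝ) (T S : Set ℂ) (ψ : ℂ → ℂ), u ∉ Λ → 0 < δ → δ ≤ η₁ → (∀ v ∈ Λ, ∀ k : ℕ, IsMetricDepth Λ v k → k ≤ K) → (∀ x ∈ t, 0 ≤ Cb x) → (∀ x ∈ t, ∀ k : ℕ, δ * (∑ᶠ v ∈ {v : HexVertex | v ∈ Λ ∧ (δ : ℂ) * hexCenter v ∈ Metric.ball x (r x) ∧ IsMetricDepth Λ v k}, starMass Λ s(u, w) v) ≤ Cb x * ((k : ℝ) + 1) ^ (3 / 4 : ℝ) * ‖hexParafermionicObservable Λ s(u, w) hexCriticalFugacity 0 b‖) → (∀ v ∈ Λ,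 (δ : ℂ) * hexCenter v ∈ T → ∀ y : HexVertex, dist (hexCenter y) (hexCenter v) ≤ η₁ / δ → y ∈ Λ) → (∀ v ∈ Λ, (δ : ℂ) * hexCenter v ∈ Metric.cthickening (δ / 2) S → (∃ x ∈ t, (δ : ℂ) * hexCenter v ∈ Metric.ball x (r x)) ∨ (δ : ℂ) * hexCenter v ∈ T) → (∀ z, ‖ψ z‖ ≤ M₁) → (∀ z, ψ z ≠ 0 → z ∈ S) → (∀ t' : HexVertex, hexGraph.Adj w t' → ψ ((δ : ℂ) * hexMidpoint s(w, t')) = 0) → ‖hexParafermionicObservable Λ s(u, w) hexCriticalFugacity (5 / 8) b‖ = ‖hexParafermionicObservable Λ s(u, w) hexCriticalFugacity 0 b‖ → 0 < ‖hexParafermionicObservable Λ s(u, w) hexCriticalFugacity 0 b‖ → ‖(δ : ℂ) ^ 2 * (∑ᶠ e ∈ hexDomainBoundary Λ, ψ ((δ : ℂ) * hexMidpoint e) * hexParafermionicObservable Λ s(u, w) hexCriticalFugacity (5 / 8) e) / hexParafermionicObservable Λ s(u, w) hexCriticalFugacity (5 / 8) b‖ ≤ 3 * M₁ * (∑ x ∈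 t, Cb x) * δ :=
  fun _ _ _ _ _ _ _ _ _ _ _ _ _ _ hu hδ hδη₁ hdepthK hCb hbudget hdeep hsplit hM₁ hψs hroot hFb hZb =>
    boundary_mesh_le hu hδ hδη₁ hdepthK hCb hbudget hdeep hsplit hM₁ hψs hroot hFb hZb

end Summit.CriticalPhenomena.SAWScalingLimit.Theorems.PolygonParitySqueeze.PolygonGreen

end
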